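import Mathlib
import HarnessLib
import Summits.NavierStokesRegularity.NavierStokesRegularity.Theses.RootDecompLitSlice
import Summits.NavierStokesRegularity.NavierStokesRegularity.Theorems.RootDecompLitSliceNoDarkBallStubNoGlobalExtinction

/-!
# RootDecompLitSlice — crux D `NoDarkBall` (stmt-NavierStokesRegularity-29563) is ONE registered stub, in the tree

The registered first-prover skeleton of D (writer g11, skeleton sha `4ad2eeb943f7…`, pattern ζ,
`NoDarkBall_of : DarkBallSpreads → NoGlobalExtinction → NoDarkBall`) has two stubs:
`stub_noGlobalExtinction` (the terminal slice of a first blow-up is not a.e. zero — a TREE THEOREM since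
writer g13's p797684, `Theorems.NoDarkBall.stub_noGlobalExtinction`: weak `L²` continuity at `T` + backward
uniqueness for classical Leray–Hopf solutions, Lemarié-Rieusset 2016 Thm. 15.4 after
Escauriaza–Seregin–Šverák 2003, + continuation of bounded solutions) and `stub_darkBallSpreads` (THE OPEN
LEMMA of D: at a first blow-up time a dark ball spreads to the whole slice — CKN slice nullity
`H¹(Sing_T) = 0`, space-like unique continuation of Escauriaza–Fernández–Vessella type at regular slice
points for the vorticity inequality, `curl = div = 0 ⟹` harmonic `⟹ 0`; its registered signature is
literally the route's aside decl `DarkBallSpreads`, stmt-NavierStokesRegularity-29566). The skeleton's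
composition lives only in the (unlanded) mirror; this file lands it: the born route decl
`Theses.RootDecompLitSlice.NoDarkBall` follows from the registered signature of `stub_darkBallSpreads`,
taken VERBATIM as a hypothesis (no new definition) — a dark ball would spread to a globally extinct slice,
which the landed stub forbids. Hence the crux ⟨29563⟩ (wanted by RootDecompLitSlice r3 and
RootDecompMorreyBudget r4) is, in the tree and by name, exactly the one open stub — the fourth such crux
after ⟨1222⟩ (wall `StubScalarLiouville`, p793469), ⟨25378⟩ (`stub_logGaugePointBounded`, p796755) and
⟨27233⟩ (`stub_thickBelowThinDeficit`, p797543). Conditional; credits nothing; Navier–Stokes regularity is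
NOT proved by anything here (rung 0). decomp-ns census instrument g27.
[cite: LemarieRieusset2016, Thm. 15.4 (p. 568)] [cite: arXiv:math/0611462, Thm. 2 (Escauriaza–Fernández–Vessella 2006)]
-/

-- the summit and its single sub-problem share the name (CONVENTIONS §1), as in every Theorems file
set_option linter.dupNamespace false

namespace Summit.NavierStokesRegularity.NavierStokesRegularity.Theorems.NoDarkBall

open Summit.NavierStokesRegularity.NavierStokesRegularity.Theses.RootDecompLitSlice

/-- **Crux ⟨29563⟩ modulo its one mathematical stub.** The registered signature of `stub_darkBallSpreads`
(hypothesis `hD1`, verbatim: for a maximal smooth solution of lifespan `T > 0`, Leray–Hopf on `[0, T]` from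
its rapidly decaying datum, if `u T = 0` a.e. on some ball then `u T = 0` a.e. on `ℝ³`) implies the route
decl `NoDarkBall`: a dark ball would spread to a globally extinct terminal slice, contradicting the landed
stub `stub_noGlobalExtinction` (p797684). [writer g11 skeleton `NoDarkBall_of`, re-targeted;
LemarieRieusset2016 Thm. 15.4; arXiv:math/0611462 Thm. 2] -/
theorem noDarkBall_of_stubDarkBallSpreads
    (hD1 : ∀ (ν T : ℝ), 0 < ν → 0 < T → ∀ (u : ℝ → EuclideanSpace ℝ (Fin 3) → EuclideanSpace ℝ (Fin 3)) (p : ℝ → EuclideanSpace ℝ (Fin 3) → ℝ), Literature.Analysis.FluidPDE.IsMaximalSmoothSolution ν 0 u p T → Literature.Analysis.FluidPDE.IsLerayHopfOn T ν 0 (u 0) u → Literature.Analysis.FluidPDE.HasRapidSpatialDecay (u 0) → ∀ (x₀ : EuclideanSpace ℝ (Fin 3)) (ρ : ℝ), 0 < ρ → (∀ᵐ x ∂(MeasureTheory.volume.restrict (Metric.ball x₀ ρ)), u T x = 0) → ∀ᵐ x ∂(MeasureTheory.volume : MeasureTheory.Measure (EuclideanSpace ℝ (Fin 3))), u T x = 0)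 :
    NoDarkBall := by
  intro ν T hν hT u p hmax hLH hdec x₀ ρ hρ hdark
  exact stub_noGlobalExtinction ν T hν hT u p hmax hLH hdec (hD1 ν T hν hT u p hmax hLH hdec x₀ ρ hρ hdark)

/-- **The open stub is the route's aside D₁ by name.** The registered signature of `stub_darkBallSpreads` is
literally the route decl `DarkBallSpreads` (aside item stmt-NavierStokesRegularity-29566), so the crux D
reads, in the tree and by name, `DarkBallSpreads → NoDarkBall`. [writer g11 skeleton; folklore composition] -/
theorem noDarkBall_of_darkBallSpreads (hD1 : DarkBallSpreads) : NoDarkBall :=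
  noDarkBall_of_stubDarkBallSpreads hD1

/-- **Conversely the crux returns its open stub** (exactness of the one-stub reading): `NoDarkBall` makes
the hypothesis «`u T = 0` a.e. on a ball» of `DarkBallSpreads` impossible, so `NoDarkBall → DarkBallSpreads`
by vacuity, and the crux D is EQUIVALENT to its open stub given nothing. [folklore] -/
theorem darkBallSpreads_of_noDarkBall (hD : NoDarkBall) : DarkBallSpreads := by
  intro ν T hν hT u p hmax hLH hdec x₀ ρ hρ hdark
  exact absurd hdark (hD ν T hν hT u p hmax hLH hdec x₀ ρ hρ)

/-- **D ⟺ D₁ in the tree** (given the landed D₂): the crux `NoDarkBall` ⟨29563⟩ and its one open stub /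
aside `DarkBallSpreads` ⟨29566⟩ are equivalent statements. [folklore] -/
theorem noDarkBall_iff_darkBallSpreads : NoDarkBall ↔ DarkBallSpreads :=
  ⟨darkBallSpreads_of_noDarkBall, noDarkBall_of_darkBallSpreads⟩

end Summit.NavierStokesRegularity.NavierStokesRegularity.Theorems.NoDarkBall
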